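import Mathlib.Algebra.Category.ModuleCat.ChangeOfRings
import Mathlib.CategoryTheory.Sites.Adjunction
import Mathlib.CategoryTheory.Sites.Abelian
import Mathlib.CategoryTheory.Sites.Limits
import Mathlib.CategoryTheory.Adjunction.Evaluation
import Mathlib.CategoryTheory.Adjunction.Limits
import Mathlib.Algebra.Category.ModuleCat.Colimits
import Mathlib.Algebra.Category.ModuleCat.Limits
import Mathlib.Algebra.Category.ModuleCat.FilteredColimits
import Mathlib.Algebra.Category.ModuleCat.Abelian
import Mathlib.Algebra.Category.ModuleCat.Injective
import Mathlib.Algebra.Category.ModuleCat.AB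
import Mathlib.Algebra.Category.ModuleCat.EpiMono
import Mathlib.Algebra.Category.ModuleCat.Kernels
import Mathlib.Algebra.Homology.ShortComplex.ModuleCat
import Mathlib.CategoryTheory.Limits.Preserves.Finite
import Mathlib.CategoryTheory.Limits.Preserves.Shapes.Kernels
import Mathlib.CategoryTheory.Preadditive.Injective.Basic
import Mathlib.CategoryTheory.Abelian.GrothendieckAxioms.Basic
import Mathlib.RingTheory.Ideal.Quotient.Operations
import HarnessLib

/-!
# Sheaves of modules on a site: change of rings `res ⊣ coind`, exactness read off from sections,
# and "sections of an injective sheaf are injective modules" (Milne III Ex. 2.25, preliminaries)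

Elementary sheaf theory on a site `(C, J)` with coefficients in `ModuleCat S`, `S` a commutative
ring, assembled from Mathlib for use in the comparison of the cohomology of a sheaf of
`R`-modules computed over `R` and over `S` along a ring homomorphism `φ : S → R` (Milne III
Ex. 2.25: "the forgetful functor `S(X, A) → S(X)` maps injective sheaves to flabby sheaves"):

* **Change of rings.** `restrictScalarsSheaf J φ` (`res`, post-composition with
  `ModuleCat.restrictScalars φ`), `coextendScalarsSheaf J φ` (`coind`, post-composition with
  `ModuleCat.coextendScalars φ`, `N ↦ Hom_S(R, N)`), the adjunctions `ext ⊣ res ⊣ coind`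
  (Mathlib `Sheaf.adjunction` applied to `extendRestrictScalarsAdj`, `restrictCoextendScalarsAdj`),
  whence `res` is exact, additive and faithful.
* **Criteria on sections.** A morphism of sheaves of modules that is injective (surjective) on all
  sections is mono (epi); a short complex of sheaves of modules that is exact on all sections is
  exact (`exact_of_sections`: exactness = "`kernel.lift` is epi", and that is checked on
  sections); the sections of `kernel g` are `ker g_U` (`range_kernel_ι_app`).
* **Injectives.** The sections `I(U)` of an injective sheaf of `S`-modules are injective
  `S`-modules (`moduleInjective_sections`: evaluation at `U` has the mono-preserving left
  adjoint "free sheaf on `U`", Mathlib `evaluationAdjunctionRight` + sheafification), and the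
  consequence of Baer's criterion used for dimension shifting: for an injective module `M` and
  `a b` with `ab = 0`, `ann(a) ⊆ (b)`, one has `aM = ker(b : M → M)` (`range_smul_id_eq_ker`).
* **The evaluation-at-`1` map** `ε : res (coind F) ⟶ F`, `f ↦ f 1` (`coindCounit`): for `φ`
  surjective it is injective on sections, and when `ker φ = (a)` its sections are exactly the
  `a`-torsion: `range ε_U = ker(a : F(U) → F(U))` (`range_coindCounit_app`); so `res (coind F)`
  is "`F[a]`".

## References

* J. S. Milne, *Étale cohomology* (reissue 2025; held copy), III Ex. 2.25 (p. 119), III 1.1–1.4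
  (injective sheaves), II 2.15 (exactness and sections). [Milne2025]
* The Stacks project, Tag 03FD (cohomology of modules vs abelian sheaves), Tag 008T.

## Design notes

* Universes: `C : Type u` with `Category.{w} C` and coefficients `ModuleCat.{w} S`, `S : Type w`
  (the shape of Mathlib's étale site `X.Etale : Type (u+1)`, `Category.{u}`, with `R : Type u`);
  the free-sheaf left adjoint of evaluation needs coproducts indexed by hom-types.
* Mathlib searches: no `restrictScalars`/`coextendScalars` for `Sheaf J (ModuleCat _)`
  (`SheafOfModules.pushforward` concerns sheaves of modules over a sheaf of rings); no lemma that
  sections of injective sheaves are injective; `ShortComplex.exact_iff_epi_kernel_lift`,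
  `PreservesKernel.iso`, `ModuleCat.kernelIsoKer`, `Module.Baer.of_injective` are used.
-/

universe w u

open CategoryTheory CategoryTheory.Limits Opposite

noncomputable section

namespace Literature.AlgebraicGeometry.Motives

/-! ### Sheaves of modules: criteria on sections -/

section Sections

variable {C : Type u} [Category.{w} C] {J : GrothendieckTopology C}
variable {S : Type w} [CommRing S] [HasSheafify J (ModuleCat.{w} S)]

omit [HasSheafify J (ModuleCat.{w} S)] in
/-- A morphism of sheaves of modules that is **injective on all sections is a monomorphism**
(the faithful `sheafToPresheaf` reflects monomorphisms, which are pointwise for presheaves).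
[folklore] -/
theorem Sheaf.mono_of_injective_sections {F G : Sheaf J (ModuleCat.{w} S)} (ψ : F ⟶ G)
    (h : ∀ U : Cᵒᵖ, Function.Injective (ψ.hom.app U)) : Mono ψ := by
  haveI : ∀ U, Mono (ψ.hom.app U) := fun U => (ModuleCat.mono_iff_injective _).2 (h U)
  haveI : Mono ((sheafToPresheaf J _).map ψ) := NatTrans.mono_of_mono_app ψ.hom
  exact (sheafToPresheaf J _).mono_of_mono_map this

omit [HasSheafify J (ModuleCat.{w} S)] in
/-- A morphism of sheaves of modules that is **surjective on all sections is an epimorphism**.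
[folklore] -/
theorem Sheaf.epi_of_surjective_sections {F G : Sheaf J (ModuleCat.{w} S)} (ψ : F ⟶ G)
    (h : ∀ U : Cᵒᵖ, Function.Surjective (ψ.hom.app U)) : Epi ψ := by
  haveI : ∀ U, Epi (ψ.hom.app U) := fun U => (ModuleCat.epi_iff_surjective _).2 (h U)
  haveI : Epi ((sheafToPresheaf J _).map ψ) := NatTrans.epi_of_epi_app ψ.hom
  exact (sheafToPresheaf J _).epi_of_epi_map this

set_option backward.isDefEq.respectTransparency false in
/-- **Sections of a kernel sheaf**: the sections over `U` of `kernel g ↪ F` are exactly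
`ker (g_U)` (limits of sheaves, and of presheaves, are computed objectwise; Mathlib
`ModuleCat.kernelIsoKer`). [folklore] -/
theorem Sheaf.range_kernel_ι_app {F G : Sheaf J (ModuleCat.{w} S)} (g : F ⟶ G) (U : Cᵒᵖ) :
    LinearMap.range ((kernel.ι g).hom.app U).hom = LinearMap.ker (g.hom.app U).hom := by
  let E := sheafToPresheaf J (ModuleCat.{w} S) ⋙ (evaluation _ (ModuleCat.{w} S)).obj U
  -- `(kernel g)(U) ≅ ker g_U`, compatibly with the inclusions into `F(U)`
  let e : E.obj (kernel g) ≅ ModuleCat.of S (LinearMap.ker (E.map g).hom) :=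
    PreservesKernel.iso E g ≪≫ ModuleCat.kernelIsoKer (E.map g)
  have he : e.hom ≫ ModuleCat.ofHom (LinearMap.ker (E.map g).hom).subtype =
      E.map (kernel.ι g) := by
    rw [Iso.trans_hom, Category.assoc, ModuleCat.kernelIsoKer_hom_ker_subtype,
      PreservesKernel.iso_hom, kernelComparison_comp_ι]
  apply le_antisymm
  · rintro _ ⟨t, rfl⟩
    rw [LinearMap.mem_ker]
    change ((kernel.ι g ≫ g).hom.app U) t = 0
    rw [kernel.condition]
    rfl
  · intro x hx
    have h1 : e.hom.hom (e.inv.hom ⟨x, hx⟩) = ⟨x, hx⟩ := by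
      rw [← ModuleCat.comp_apply, e.inv_hom_id]
      rfl
    have h2 := congrArg (fun ψ => (ModuleCat.Hom.hom ψ) (e.inv.hom ⟨x, hx⟩)) he
    simp only [ModuleCat.hom_comp, LinearMap.comp_apply, ModuleCat.hom_ofHom, h1,
      Submodule.subtype_apply] at h2
    exact ⟨e.inv.hom ⟨x, hx⟩, h2.symm⟩

set_option backward.isDefEq.respectTransparency false in
/-- Sections of `kernel.ι g` are injective. [folklore] -/
theorem Sheaf.injective_kernel_ι_app {F G : Sheaf J (ModuleCat.{w} S)} (g : F ⟶ G) (U : Cᵒᵖ) :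
    Function.Injective ((kernel.ι g).hom.app U) := by
  let E := sheafToPresheaf J (ModuleCat.{w} S) ⋙ (evaluation _ (ModuleCat.{w} S)).obj U
  let e : E.obj (kernel g) ≅ ModuleCat.of S (LinearMap.ker (E.map g).hom) :=
    PreservesKernel.iso E g ≪≫ ModuleCat.kernelIsoKer (E.map g)
  have he : e.hom ≫ ModuleCat.ofHom (LinearMap.ker (E.map g).hom).subtype =
      E.map (kernel.ι g) := by
    rw [Iso.trans_hom, Category.assoc, ModuleCat.kernelIsoKer_hom_ker_subtype,
      PreservesKernel.iso_hom, kernelComparison_comp_ι]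
  change Function.Injective (E.map (kernel.ι g)).hom
  rw [← he, ModuleCat.hom_comp, ModuleCat.hom_ofHom, LinearMap.coe_comp]
  exact Subtype.val_injective.comp e.toLinearEquiv.injective

/-- **Sections of `kernel.lift`**: if `range f_U ⊇ ker g_U` then `(kernel.lift g f w)_U` is
surjective onto the sections of `kernel g`. [folklore] -/
theorem Sheaf.surjective_kernel_lift_app {F G H : Sheaf J (ModuleCat.{w} S)} (g : G ⟶ H)
    (f : F ⟶ G) (w : f ≫ g = 0) (U : Cᵒᵖ)
    (h : LinearMap.ker (g.hom.app U).hom ≤ LinearMap.range (f.hom.app U).hom) :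
    Function.Surjective ((kernel.lift g f w).hom.app U) := by
  intro t
  have ht : (kernel.ι g).hom.app U t ∈ LinearMap.ker (g.hom.app U).hom := by
    rw [← Sheaf.range_kernel_ι_app]
    exact ⟨t, rfl⟩
  obtain ⟨y, hy⟩ := h ht
  refine ⟨y, Sheaf.injective_kernel_ι_app g U ?_⟩
  change ((kernel.lift g f w).hom.app U ≫ (kernel.ι g).hom.app U) y = _
  rw [← NatTrans.comp_app, ← ObjectProperty.FullSubcategory.comp_hom, kernel.lift_ι]
  exact hy

/-- A short complex of sheaves of modules that is **exact on all sections is exact** (exactness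
need not be checked after sheafification: it means that `kernel.lift g f` is epi, Mathlib
`ShortComplex.exact_iff_epi_kernel_lift`, and that morphism is then surjective on all sections;
Milne II 2.15 for the converse direction on stalks). [folklore] -/
theorem Sheaf.exact_of_sections (T : ShortComplex (Sheaf J (ModuleCat.{w} S)))
    (h : ∀ U : Cᵒᵖ, LinearMap.range (T.f.hom.app U).hom = LinearMap.ker (T.g.hom.app U).hom) :
    T.Exact := by
  rw [ShortComplex.exact_iff_epi_kernel_lift]
  apply Sheaf.epi_of_surjective_sections
  intro U
  exact Sheaf.surjective_kernel_lift_app T.g T.f T.zero U (h U).ge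

end Sections

/-! ### Sections of injective sheaves are injective modules; a consequence of Baer's criterion -/

section Injectives

variable {C : Type u} [Category.{w} C] (J : GrothendieckTopology C)
variable {S : Type w} [CommRing S] [HasSheafify J (ModuleCat.{w} S)]

/-- Coproducts of monomorphisms are monomorphisms in `ModuleCat S` (coproducts are exact, AB4).
[folklore] -/
theorem ModuleCat.mono_sigmaMap {ι : Type w} (f g : ι → ModuleCat.{w} S) (p : ∀ j, f j ⟶ g j)
    [∀ j, Mono (p j)] : Mono (Limits.Sigma.map p) := by
  have : ∀ j : Discrete ι, Mono ((Discrete.natTrans (fun j => p j.as) :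
      Discrete.functor f ⟶ Discrete.functor g).app j) := fun ⟨j⟩ => inferInstanceAs (Mono (p j))
  have : Mono (Discrete.natTrans (fun j => p j.as) : Discrete.functor f ⟶ Discrete.functor g) :=
    NatTrans.mono_of_mono_app _
  change Mono (colim.map (Discrete.natTrans (fun j => p j.as) :
    Discrete.functor f ⟶ Discrete.functor g))
  infer_instance

/-- The left adjoint of evaluation at `U` on `ModuleCat S`-valued presheaves,
`M ↦ (V ↦ ⨁_{U → V} M)` (Mathlib `evaluationLeftAdjoint`), preserves monomorphisms. [folklore] -/
instance evaluationLeftAdjoint_preservesMonomorphisms (U : Cᵒᵖ) :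
    (evaluationLeftAdjoint (ModuleCat.{w} S) U).PreservesMonomorphisms where
  preserves {d d'} δ hδ := by
    haveI : ∀ t, Mono (((evaluationLeftAdjoint (ModuleCat.{w} S) U).map δ).app t) := fun t => by
      dsimp [evaluationLeftAdjoint]
      have : (Sigma.desc fun (h : U ⟶ t) => δ ≫ Sigma.ι (fun _ => d') h) =
          Limits.Sigma.map (fun _ => δ) := by
        apply Sigma.hom_ext
        intro h
        rw [Sigma.ι_desc, Sigma.ι_map]
      rw [this]
      exact ModuleCat.mono_sigmaMap _ _ _
    apply NatTrans.mono_of_mono_app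

/-- **"Free sheaf on `U`" ⊣ evaluation at `U`**: `M ↦ a(V ↦ ⨁_{U → V} M)` is left adjoint to
`F ↦ F(U)` on sheaves of modules (Mathlib `evaluationAdjunctionRight` composed with the
sheafification adjunction); this is the adjunction behind Milne's sheaves `ℤ_U` with
`Hom(ℤ_U, F) = F(U)` (III, proofs of 2.4 and 2.13 (c)). [folklore] -/
def freeSheafEvaluationAdj (U : Cᵒᵖ) :
    evaluationLeftAdjoint (ModuleCat.{w} S) U ⋙ presheafToSheaf J _ ⊣
      sheafToPresheaf J _ ⋙ (evaluation _ (ModuleCat.{w} S)).obj U :=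
  (evaluationAdjunctionRight (ModuleCat.{w} S) U).comp (sheafificationAdjunction J _)

/-- **Sections of an injective sheaf of modules are injective objects** of `ModuleCat S`
(evaluation at `U` has a mono-preserving left adjoint). [folklore] -/
theorem injective_sections (I₀ : Sheaf J (ModuleCat.{w} S)) [Injective I₀] (U : Cᵒᵖ) :
    Injective (I₀.obj.obj U) :=
  Injective.injective_of_adjoint (freeSheafEvaluationAdj J U) I₀

/-- **Sections of an injective sheaf of `S`-modules are injective `S`-modules.** [folklore] -/
theorem moduleInjective_sections (I₀ : Sheaf J (ModuleCat.{w} S)) [Injective I₀] (U : Cᵒᵖ) :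
    Module.Injective S (I₀.obj.obj U) :=
  haveI := injective_sections J I₀ U
  Module.injective_module_of_injective_object S (I₀.obj.obj U)

omit [HasSheafify J (ModuleCat.{w} S)] in
/-- **Baer's criterion, dimension-shifting form**: for an injective `S`-module `M` and `a, b ∈ S`
with `ab = 0` and `ann(a) ⊆ (b)`, one has `aM = ker(b · : M → M)`: given `x` with `bx = 0`, the
map `sa ↦ sx` is well defined on the ideal `(a) ≅ S/ann(a)` and extends to `S → M` by Baer's
criterion (Mathlib `Module.Baer.of_injective`); its value at `1` is the required `y` with
`ay = x`. [folklore] -/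
theorem range_smul_id_eq_ker {M : Type w} [AddCommGroup M] [Module S M]
    (hM : Module.Injective S M) (a b : S) (hab : a * b = 0)
    (hann : ∀ s : S, s * a = 0 → ∃ t, s = t * b) :
    LinearMap.range (a • (LinearMap.id : M →ₗ[S] M)) = LinearMap.ker (b • LinearMap.id) := by
  apply le_antisymm
  · rintro _ ⟨y, rfl⟩
    simp only [LinearMap.mem_ker, LinearMap.smul_apply, LinearMap.id_coe, id_eq, smul_smul,
      mul_comm b a, hab, zero_smul]
  · intro x hx
    simp only [LinearMap.mem_ker, LinearMap.smul_apply, LinearMap.id_coe, id_eq] at hx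
    let μ : S →ₗ[S] S := LinearMap.mulRight S a
    have hker : LinearMap.ker μ ≤ LinearMap.ker (LinearMap.toSpanSingleton S M x) := by
      intro s hs
      simp only [LinearMap.mem_ker, μ, LinearMap.mulRight_apply] at hs
      obtain ⟨t, rfl⟩ := hann s hs
      simp [LinearMap.toSpanSingleton_apply, mul_smul, hx]
    let g : LinearMap.range μ →ₗ[S] M :=
      ((LinearMap.ker μ).liftQ (LinearMap.toSpanSingleton S M x) hker) ∘ₗ
        μ.quotKerEquivRange.symm.toLinearMap
    obtain ⟨g', hg'⟩ := Module.Baer.of_injective hM (LinearMap.range μ) g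
    have ha : a ∈ LinearMap.range μ := ⟨1, by simp [μ]⟩
    refine ⟨g' 1, ?_⟩
    have h1 : μ.quotKerEquivRange.symm ⟨a, ha⟩ = Submodule.Quotient.mk 1 := by
      apply μ.quotKerEquivRange.injective
      rw [LinearEquiv.apply_symm_apply]
      ext
      rw [LinearMap.quotKerEquivRange_apply_mk]
      simp [μ]
    calc (a • (LinearMap.id : M →ₗ[S] M)) (g' 1) = g' (a • 1) := by
          rw [LinearMap.smul_apply, LinearMap.id_apply, ← map_smul]
      _ = g ⟨a, ha⟩ := by rw [smul_eq_mul, mul_one]; exact hg' a ha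
      _ = x := by
          simp only [g, LinearMap.coe_comp, Function.comp_apply, LinearEquiv.coe_coe, h1,
            Submodule.liftQ_apply, LinearMap.toSpanSingleton_apply, one_smul]

end Injectives

/-! ### Change of rings for sheaves of modules: `ext ⊣ res ⊣ coind` -/

section ChangeOfRings

variable {C : Type u} [Category.{w} C] (J : GrothendieckTopology C)
variable {S R : Type w} [CommRing S] [CommRing R] (φ : S →+* R)

/-- Coextension of scalars `N ↦ Hom_S(R, N)` with the universes pinned to `ModuleCat.{w}`.
[folklore] -/
abbrev coextendScalars' : ModuleCat.{w} S ⥤ ModuleCat.{w} R := ModuleCat.coextendScalars φ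

/-- **Restriction of scalars `res : S(X, R) ⥤ S(X, S)`** along `φ : S → R` for sheaves of modules
(post-composition with `ModuleCat.restrictScalars φ`, which preserves limits; Milne III Ex. 2.25,
"the forgetful functor `S(X, A) → S(X)`"). [cite: Milne2025, III Exercise 2.25] -/
def restrictScalarsSheaf : Sheaf J (ModuleCat.{w} R) ⥤ Sheaf J (ModuleCat.{w} S) :=
  sheafCompose J (ModuleCat.restrictScalars.{w} φ)

/-- **Coextension of scalars `coind : S(X, S) ⥤ S(X, R)`**, `F ↦ (U ↦ Hom_S(R, F(U)))`
(post-composition with `ModuleCat.coextendScalars φ`, a right adjoint). [folklore] -/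
def coextendScalarsSheaf : Sheaf J (ModuleCat.{w} S) ⥤ Sheaf J (ModuleCat.{w} R) :=
  sheafCompose J (coextendScalars' φ)

/-- `(res G)(U) = G(U)` viewed as an `S`-module. [folklore] -/
@[simp]
theorem restrictScalarsSheaf_obj_obj_obj (G : Sheaf J (ModuleCat.{w} R)) (U : Cᵒᵖ) :
    ((restrictScalarsSheaf J φ).obj G).obj.obj U =
      (ModuleCat.restrictScalars.{w} φ).obj (G.obj.obj U) :=
  rfl

/-- `res` on morphisms is componentwise restriction of scalars. [folklore] -/
@[simp]
theorem restrictScalarsSheaf_map_hom_app {G G' : Sheaf J (ModuleCat.{w} R)} (ψ : G ⟶ G')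
    (U : Cᵒᵖ) :
    ((restrictScalarsSheaf J φ).map ψ).hom.app U =
      (ModuleCat.restrictScalars.{w} φ).map (ψ.hom.app U) :=
  rfl

variable [HasWeakSheafify J (ModuleCat.{w} R)] [HasWeakSheafify J (ModuleCat.{w} S)]

/-- For a functor `G` that preserves sheaves, "compose and sheafify" is post-composition
(sheafifying a sheaf does nothing: the counit of the sheafification adjunction is an iso).
[folklore] -/
def composeAndSheafifyIsoSheafCompose {A B : Type*} [Category A] [Category B] (G : A ⥤ B)
    [HasWeakSheafify J B] [J.HasSheafCompose G] :
    Sheaf.composeAndSheafify J G ≅ sheafCompose J G :=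
  Functor.isoWhiskerLeft (sheafCompose J G) (asIso (sheafificationAdjunction J B).counit)
    ≪≫ Functor.rightUnitor _

/-- **`res ⊣ coind`** for sheaves of modules (from Mathlib's `restrictCoextendScalarsAdj` via
`Sheaf.adjunction`). [folklore] -/
def restrictCoextendScalarsSheafAdj : restrictScalarsSheaf J φ ⊣ coextendScalarsSheaf J φ :=
  (Sheaf.adjunction J (ModuleCat.restrictCoextendScalarsAdj φ :
      ModuleCat.restrictScalars.{w} φ ⊣ coextendScalars' φ)).ofNatIsoLeft
    (composeAndSheafifyIsoSheafCompose J (ModuleCat.restrictScalars.{w} φ))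

/-- **`ext ⊣ res`**: sheafified extension of scalars `F ↦ a(R ⊗_S F)` is left adjoint to `res`
(from Mathlib's `extendRestrictScalarsAdj`). [folklore] -/
def extendRestrictScalarsSheafAdj :
    Sheaf.composeAndSheafify J (ModuleCat.extendScalars φ : ModuleCat.{w} S ⥤ ModuleCat.{w} R) ⊣
      restrictScalarsSheaf J φ :=
  Sheaf.adjunction J (ModuleCat.extendRestrictScalarsAdj φ :
    (ModuleCat.extendScalars φ : ModuleCat.{w} S ⥤ ModuleCat.{w} R) ⊣
      ModuleCat.restrictScalars.{w} φ)

/-- `res` is a left adjoint. [folklore] -/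
instance restrictScalarsSheaf_isLeftAdjoint : (restrictScalarsSheaf J φ).IsLeftAdjoint :=
  (restrictCoextendScalarsSheafAdj J φ).isLeftAdjoint

/-- `res` is a right adjoint. [folklore] -/
instance restrictScalarsSheaf_isRightAdjoint : (restrictScalarsSheaf J φ).IsRightAdjoint :=
  (extendRestrictScalarsSheafAdj J φ).isRightAdjoint

omit [HasWeakSheafify J (ModuleCat.{w} R)] [HasWeakSheafify J (ModuleCat.{w} S)] in
/-- `res` is additive. [folklore] -/
instance restrictScalarsSheaf_additive : (restrictScalarsSheaf J φ).Additive where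
  map_add := by
    intros
    apply Sheaf.hom_ext
    ext : 2
    rfl

omit [HasWeakSheafify J (ModuleCat.{w} R)] [HasWeakSheafify J (ModuleCat.{w} S)] in
/-- `res` is faithful. [folklore] -/
instance restrictScalarsSheaf_faithful : (restrictScalarsSheaf J φ).Faithful where
  map_injective {F G} a b h := by
    apply Sheaf.hom_ext
    ext U : 2
    have := congrArg (fun ψ => (ψ.hom.app U)) h
    dsimp [restrictScalarsSheaf] at this
    ext x
    exact congrArg (fun g => g x) (congrArg (fun g => (ModuleCat.Hom.hom g : _ → _)) this)

variable [HasSheafify J (ModuleCat.{w} R)] [HasSheafify J (ModuleCat.{w} S)]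

/-- **`res` is exact**: left exact as a right adjoint. [cite: Milne2025, III Exercise 2.25] -/
instance restrictScalarsSheaf_preservesFiniteLimits :
    PreservesFiniteLimits (restrictScalarsSheaf J φ) := by
  have : PreservesLimitsOfSize.{0, 0} (restrictScalarsSheaf J φ) :=
    (extendRestrictScalarsSheafAdj J φ).rightAdjoint_preservesLimits
  exact PreservesLimitsOfSize.preservesFiniteLimits _

/-- **`res` is exact**: right exact as a left adjoint. [cite: Milne2025, III Exercise 2.25] -/
instance restrictScalarsSheaf_preservesFiniteColimits :
    PreservesFiniteColimits (restrictScalarsSheaf J φ) := by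
  have : PreservesColimitsOfSize.{0, 0} (restrictScalarsSheaf J φ) :=
    (restrictCoextendScalarsSheafAdj J φ).leftAdjoint_preservesColimits
  exact PreservesColimitsOfSize.preservesFiniteColimits _

end ChangeOfRings

/-! ### The evaluation-at-`1` map `res (coind F) → F` and its sections -/

section Counit

variable {C : Type u} [Category.{w} C] (J : GrothendieckTopology C)
variable {S R : Type w} [CommRing S] [CommRing R] (φ : S →+* R)

/-- **Evaluation at `1`**, `ε : res (coind F) ⟶ F`, `(f : Hom_S(R, F(U))) ↦ f 1`, for a sheaf of
`S`-modules `F` (componentwise Mathlib's counit `RestrictionCoextensionAdj.counit'`). [folklore] -/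
def coindCounit (F : Sheaf J (ModuleCat.{w} S)) :
    (restrictScalarsSheaf J φ).obj ((coextendScalarsSheaf J φ).obj F) ⟶ F :=
  ⟨Functor.whiskerLeft F.obj (ModuleCat.RestrictionCoextensionAdj.counit' φ) ≫
    (Functor.rightUnitor _).hom⟩

/-- `ε_U f = f 1`. [folklore] -/
@[simp]
theorem coindCounit_app_apply (F : Sheaf J (ModuleCat.{w} S)) (U : Cᵒᵖ)
    (f : ((restrictScalarsSheaf J φ).obj ((coextendScalarsSheaf J φ).obj F)).obj.obj U) :
    (coindCounit J φ F).hom.app U f = ModuleCat.CoextendScalars.equiv φ _ f (1 : R) :=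
  rfl

set_option backward.isDefEq.respectTransparency false in
/-- For `φ` **surjective**, `ε_U` is **injective**: an `S`-linear `f : R → F(U)` is determined by
`f 1` (`f(φ s) = s f(1)`). [folklore] -/
theorem injective_coindCounit_app (hφ : Function.Surjective φ) (F : Sheaf J (ModuleCat.{w} S))
    (U : Cᵒᵖ) : Function.Injective ((coindCounit J φ F).hom.app U) := by
  intro f g hfg
  rw [coindCounit_app_apply, coindCounit_app_apply] at hfg
  apply ModuleCat.CoextendScalars.ext
  apply LinearMap.ext
  intro r
  obtain ⟨s, rfl⟩ := hφ r
  have key : ∀ h : ((restrictScalarsSheaf J φ).obj ((coextendScalarsSheaf J φ).obj F)).obj.obj U,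
      ModuleCat.CoextendScalars.equiv φ _ h (φ s) =
        s • ModuleCat.CoextendScalars.equiv φ _ h (1 : R) := fun h => by
    rw [← LinearMap.map_smul]
    congr 1
    exact (mul_one (φ s)).symm
  rw [key f, key g, hfg]

set_option backward.isDefEq.respectTransparency false in
/-- `a · ε_U f = 0` when `φ a = 0` (so `range ε_U ⊆ ker a`). [folklore] -/
theorem smul_coindCounit_app_eq_zero {a : S} (ha : φ a = 0) (F : Sheaf J (ModuleCat.{w} S))
    (U : Cᵒᵖ) (f : ((restrictScalarsSheaf J φ).obj ((coextendScalarsSheaf J φ).obj F)).obj.obj U) :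
    a • (coindCounit J φ F).hom.app U f = 0 := by
  rw [coindCounit_app_apply]
  have h1 : a • ModuleCat.CoextendScalars.equiv φ _ f (1 : R) =
      ModuleCat.CoextendScalars.equiv φ _ f
        (a • (show (ModuleCat.restrictScalars φ).obj (ModuleCat.of R R) from (1 : R))) :=
    (LinearMap.map_smul _ _ _).symm
  have h2 : (a • (show (ModuleCat.restrictScalars φ).obj (ModuleCat.of R R) from (1 : R))) = 0 := by
    change φ a * 1 = 0
    rw [ha, zero_mul]
  rw [h1, h2, map_zero]

set_option backward.isDefEq.respectTransparency false in
/-- For `φ` surjective with `ker φ = (a)`, every `a`-torsion section `x ∈ F(U)` is `ε_U` of the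
`S`-linear map `R ≅ S/(a) → F(U)` induced by `s ↦ s x`. [folklore] -/
theorem exists_coindCounit_app_eq (hφ : Function.Surjective φ) {a : S}
    (hker : RingHom.ker φ = Ideal.span {a}) (F : Sheaf J (ModuleCat.{w} S)) (U : Cᵒᵖ)
    (x : F.obj.obj U) (hx : a • x = 0) :
    ∃ f, (coindCounit J φ F).hom.app U f = x := by
  -- the `S`-linear map `s ↦ s • x` kills `ker φ`
  have hk : RingHom.ker φ ≤ LinearMap.ker (LinearMap.toSpanSingleton S (F.obj.obj U) x) := by
    intro s hs
    rw [hker, Ideal.mem_span_singleton'] at hs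
    obtain ⟨t, rfl⟩ := hs
    simp [LinearMap.toSpanSingleton_apply, mul_smul, hx]
  let ψ : (S ⧸ RingHom.ker φ) →ₗ[S] F.obj.obj U :=
    (RingHom.ker φ).liftQ (LinearMap.toSpanSingleton S (F.obj.obj U) x) hk
  let e : (S ⧸ RingHom.ker φ) ≃+* R := RingHom.quotientKerEquivOfSurjective hφ
  have he : ∀ s : S, e.symm (φ s) = Ideal.Quotient.mk _ s := fun s => by
    apply e.injective
    rw [RingEquiv.apply_symm_apply]
    exact (RingHom.quotientKerEquivOfSurjective_apply_mk hφ s).symm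
  -- the `S`-linear map `R → F(U)`, `φ s ↦ s • x`
  let g : (ModuleCat.restrictScalars φ).obj (ModuleCat.of R R) →ₗ[S] F.obj.obj U :=
    { toFun := fun r => ψ (e.symm (show R from r))
      map_add' := fun r r' => by
        show ψ (e.symm ((show R from r) + (show R from r'))) = _
        rw [map_add, map_add]
      map_smul' := fun s r => by
        obtain ⟨t, ht⟩ := hφ (show R from r)
        show ψ (e.symm (φ s * (show R from r))) = s • ψ (e.symm (show R from r))
        rw [← ht, ← map_mul, he, he, ← map_smul]
        rfl }
  refine ⟨(ModuleCat.CoextendScalars.equiv φ _).symm g, ?_⟩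
  rw [coindCounit_app_apply, LinearEquiv.apply_symm_apply]
  change ψ (e.symm 1) = x
  rw [← φ.map_one, he]
  change LinearMap.toSpanSingleton S (F.obj.obj U) x 1 = x
  rw [LinearMap.toSpanSingleton_apply, one_smul]

/-- **Sections of `res (coind F)` are the `a`-torsion sections of `F`**: for `φ : S → R` surjective
with `ker φ = (a)`, `range ε_U = ker(a · : F(U) → F(U))` (`Hom_S(S/(a), M) = M[a]`). [folklore] -/
theorem range_coindCounit_app (hφ : Function.Surjective φ) {a : S}
    (hker : RingHom.ker φ = Ideal.span {a}) (F : Sheaf J (ModuleCat.{w} S)) (U : Cᵒᵖ) :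
    LinearMap.range ((coindCounit J φ F).hom.app U).hom =
      LinearMap.ker (a • (LinearMap.id : F.obj.obj U →ₗ[S] F.obj.obj U)) := by
  have ha : φ a = 0 := by
    rw [← RingHom.mem_ker, hker]
    exact Ideal.mem_span_singleton_self a
  apply le_antisymm
  · rintro _ ⟨f, rfl⟩
    exact smul_coindCounit_app_eq_zero J φ ha F U f
  · intro x hx
    exact exists_coindCounit_app_eq J φ hφ hker F U x hx

end Counit

end Literature.AlgebraicGeometry.Motives
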